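import Summits.ValiantsHypothesis.ValiantsHypothesis.Theorems.BarrierLeverPartitionMinorsHitByVPHiddenStatesShadowRankTriplesSpan

/-!
# Route BarrierLever — item `PartitionMinorsHitByVP` (stmt-ValiantsHypothesis-19717), line `hidden_states`:
# THE TRIPLE SPAN BOUND — triple columns on `n` states against rows of size `≤ 3q+2` span at most `C(n,2)·N − n·C(N,2) + C(N,3)`

Helper file (`--supports stmt-ValiantsHypothesis-19717`; cell valiant-natproofs, rung V4, 𝒟-side door (c), line
`hidden_states`, node #1 `stub_universalJoinWide`; prover seat val-np-p3 gen 19). Definition-free apart from bookkeeping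
`def`s (only the counting function `kept`; the column-functions and the spanning family are part A,
`…HiddenStatesShadowRankTriplesSpan`). Closes NO item: it is the level-3 term
of the KOSZUL-TYPE SPAN LAW (memo HOME/val-np-p3/g19/MEMO-hybrid-valnp3-g19.md §9b: for a complete level-`t` block on `m`
states the column-functions span EXACTLY `C(m,t) − max(0, [zᵗ](1+z)ᵐ(1−z)ᴺ)` dimensions in every computed case; the
pair file `…ShadowRankPairs` proves the `t = 2` bound `nN − C(N,2)`, this file the `t = 3` bound).

THE BOUND. One table, hidden family `e` whose three-state members live inside `S` (`|S| = n`), rows `u i ⊆ T` of size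
`≤ s < 3(q+1)`, `N := #{V ⊆ T : |V| ≤ q}`. By part 1 (`prod_eq_sum_coef`, `t = 3`) every row restricted to the triple
columns is a combination of `Ψ₃_{A,V} : J ↦ [A ⊂ J]·β_{J∖A}(V)` (`A` a 2-set). In the coordinates `r` of `…ShadowRankPairs`
(`exists_coords`: `β_p = Σ_{p₀∈S₀} r(p,p₀)β_{p₀}`, `r = δ` on `S₀`, `|S₀| = e ≤ N`), `Ψ₃_{A,V} = Σ_{p₀} β_{p₀}(V)·Ψ₃''_{A,p₀}` and
the relations `Σ_{b} r(b,p₁)Ψ₃''_{{a,b},p₂} = Σ_b r(b,p₂)Ψ₃''_{{a,b},p₁}` (one family per state `a` — the `Λ²`-valued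
relations of the Koszul complex; `psi3_relation`) leave the spanning family
  `{Ψ₃''_{A,p₀} : A ⊆ S∖S₀} ∪ {Ψ₃''_{{a,p},p₀} : a ∉ S₀, p ≤ p₀ ∈ S₀} ∪ {Ψ₃''_{T∖max T, max T} : T ⊆ S₀, |T| = 3}`
of size `C(n−e,2)e + (n−e)C(e+1,2) + C(e,3)`, which is `≤ C(n,2)N − nC(N,2) + C(N,3)` when `e ≤ N ≤ n` and `N ≤ C(n−N,2)`
(`kept_le`; the triple syzygies `Λ³` are the `C(e,3)`). Hence (`det_eq_zero_triples`): if
  `#{k : |e k| ≠ 3} + C(n,2)·N + C(N,3) < #columns + n·C(N,2)`,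
the matrix is SINGULAR FOR EVERY TABLE. Example: 5-rows (`q = 1`, `N = h+1`), a complete triple block on `m` states is
singular once `[z³](1+z)ᵐ(1−z)^{h+1} > 0`, e.g. `h = 14`, `m ≥ 29`. WHAT THIS IS NOT: no lower bound on the rank; the
measured TOTAL 3-fold law of a flat piece has an extra cross-level loss (memo §9c) not captured by block bounds; nothing
on crux 14610 or VP ≠ VNP.
-/

set_option linter.dupNamespace false

namespace Summit.ValiantsHypothesis.ValiantsHypothesis.Theorems.BarrierLever.HiddenStates

open Finset

noncomputable section

namespace ShadowRank

variable {K h : ℕ} {n : Type*}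

/-! ## Rows in the span, the count, the singular conclusion -/

section rows

variable [Fintype n] [DecidableEq n] (u : n → Finset (Fin h)) (e : n → Finset (Fin K)) (S S₀ : Finset (Fin K))
  (T : Finset (Fin h)) (q : ℕ) (tx : Option (Fin K) → Fin h → ℂ) (r : Fin K → Fin K → ℂ)

omit [Fintype n] [DecidableEq n] in
/-- `Ψ₃_{A,V}` in coordinates: `Ψ₃_{A,V} = Σ_{p₀ ∈ S₀} β_{p₀}(V) • Ψ₃''_{A,p₀}`. -/
theorem Psi3_eq_sum (heS : ∀ k, (e k).card = 3 → e k ⊆ S)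
    (hcoord : ∀ p ∈ S, ∀ V ∈ smallSets T q, feat tx p V = ∑ p₀ ∈ S₀, r p p₀ * feat tx p₀ V)
    (A : Finset (Fin K)) (V : Finset (Fin h)) (hV : V ∈ smallSets T q) :
    Psi3 e tx A V = ∑ p₀ ∈ S₀, feat tx p₀ V • psi3 e r A p₀ := by
  classical
  funext k
  simp only [Finset.sum_apply, Pi.smul_apply, smul_eq_mul, Psi3, psi3]
  by_cases hk : (e k).card = 3 ∧ A ⊆ e k
  · simp only [if_pos hk]
    rw [Finset.sum_congr rfl fun c hc => hcoord c (heS k hk.1 (Finset.mem_sdiff.mp hc).1) V hV,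
      Finset.sum_comm]
    refine Finset.sum_congr rfl fun p₀ _ => ?_
    rw [Finset.mul_sum]
    exact Finset.sum_congr rfl fun _ _ => mul_comm _ _
  · simp [hk]

/-- **Every row of size `≤ s < 3(q+1)` inside `T` lies in the span of the family.** -/
theorem row_mem_span_triples {s : ℕ} (hsq : s < 3 * (q + 1))
    (heS : ∀ k, (e k).card = 3 → e k ⊆ S) (hS₀ : S₀ ⊆ S)
    (hδ : ∀ p ∈ S₀, ∀ p₀, r p p₀ = if p = p₀ then 1 else 0)
    (hcoord : ∀ p ∈ S, ∀ V ∈ smallSets T q, feat tx p V = ∑ p₀ ∈ S₀, r p p₀ * feat tx p₀ V)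
    (i : n) (hiT : u i ⊆ T) (his : (u i).card ≤ s) :
    (fun k => ∏ a ∈ u i, (tx none a + ∑ p ∈ e k, tx (some p) a)) ∈
      Submodule.span ℂ (Set.range (famVec3 e S S₀ r)) := by
  classical
  have hfe : ∀ (p : Fin K) (V : Finset (Fin h)), ∏ a ∈ V, tx (some p) a = feat tx p V := fun _ _ => rfl
  -- the decomposition of the row
  have hdec : (fun k => ∏ a ∈ u i, (tx none a + ∑ p ∈ e k, tx (some p) a)) =
      (∑ k₀ : {k : n // (e k).card ≠ 3},
          (∏ a ∈ u i, (tx none a + ∑ p ∈ e k₀.1, tx (some p) a)) • famVec3 e S S₀ r (Sum.inl k₀)) +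
        ∑ A ∈ S.powersetCard 2, ∑ V ∈ smallSets T q, coef q tx (u i) A V • Psi3 e tx A V := by
    funext k
    simp only [Pi.add_apply, Finset.sum_apply, Pi.smul_apply, smul_eq_mul]
    by_cases hk : (e k).card = 3
    · -- a triple column: the indicator part vanishes, the rest is part 1's expansion, re-indexed by `A = J.erase p`
      have h0 : ∑ k₀ : {k : n // (e k).card ≠ 3},
          (∏ a ∈ u i, (tx none a + ∑ p ∈ e k₀.1, tx (some p) a)) * famVec3 e S S₀ r (Sum.inl k₀) k = 0 := by
        refine Finset.sum_eq_zero fun k₀ _ => ?_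
        have : k ≠ k₀.1 := fun hkk => k₀.2 (by rw [← hkk]; exact hk)
        simp [famVec3, this]
      rw [h0, zero_add, prod_eq_sum_coef (q := q) (s := s) (t := 3) (by omega) tx hiT his hk]
      have hsubset : (e k).powersetCard 2 ⊆ S.powersetCard 2 := Finset.powersetCard_mono (heS k hk)
      rw [← Finset.sum_subset hsubset (fun A hA hA' => ?_)]
      · have himg : (e k).powersetCard 2 = (e k).image (fun p => (e k).erase p) := by
          ext A
          rw [Finset.mem_powersetCard, Finset.mem_image]
          constructor
          · rintro ⟨hAJ, hA2⟩
            have hc : ((e k) \ A).card = 1 := by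
              have := Finset.card_sdiff_add_card_eq_card hAJ
              omega
            obtain ⟨p, hp⟩ := Finset.card_eq_one.mp hc
            have hpJ : p ∈ e k ∧ p ∉ A := by
              have : p ∈ e k \ A := by rw [hp]; exact Finset.mem_singleton_self p
              exact Finset.mem_sdiff.mp this
            refine ⟨p, hpJ.1, ?_⟩
            ext a
            simp only [Finset.mem_erase]
            constructor
            · rintro ⟨hap, haJ⟩
              by_contra haA
              have : a ∈ e k \ A := Finset.mem_sdiff.mpr ⟨haJ, haA⟩
              rw [hp, Finset.mem_singleton] at this
              exact hap this
            · intro haA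
              exact ⟨fun hap => hpJ.2 (hap ▸ haA), hAJ haA⟩
          · rintro ⟨p, hp, rfl⟩
            exact ⟨Finset.erase_subset _ _, by rw [Finset.card_erase_of_mem hp, hk]⟩
        rw [himg, Finset.sum_image (fun p hp p' hp' hpp => Finset.erase_injOn _ hp hp' hpp)]
        refine Finset.sum_congr rfl fun p hp => Finset.sum_congr rfl fun V _ => ?_
        have hsd : e k \ (e k).erase p = {p} := by
          ext a
          simp only [Finset.mem_sdiff, Finset.mem_erase, Finset.mem_singleton, not_and]
          constructor
          · rintro ⟨ha, hne⟩
            by_contra hap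
            exact hne hap ha
          · rintro rfl
            exact ⟨hp, fun h' _ => h' rfl⟩
        rw [Psi3, if_pos ⟨hk, Finset.erase_subset _ _⟩, hsd, Finset.sum_singleton, hfe]
      · have : ¬ ((e k).card = 3 ∧ A ⊆ e k) := fun h' =>
          hA' (Finset.mem_powersetCard.mpr ⟨h'.2, (Finset.mem_powersetCard.mp hA).2⟩)
        simp [Psi3, this]
    · -- a column off the triple level: only its own indicator survives
      have h1 : ∑ A ∈ S.powersetCard 2, ∑ V ∈ smallSets T q, coef q tx (u i) A V * Psi3 e tx A V k = 0 := by
        refine Finset.sum_eq_zero fun A _ => Finset.sum_eq_zero fun V _ => ?_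
        simp [Psi3, hk]
      rw [h1, add_zero, Finset.sum_eq_single ⟨k, hk⟩]
      · simp [famVec3]
      · intro k₀ _ hk₀
        have : k ≠ k₀.1 := fun hkk => hk₀ (Subtype.ext hkk.symm)
        simp [famVec3, this]
      · simp
  rw [hdec]
  refine Submodule.add_mem _ (Submodule.sum_mem _ fun k₀ _ =>
    Submodule.smul_mem _ _ (Submodule.subset_span ⟨Sum.inl k₀, rfl⟩)) ?_
  refine Submodule.sum_mem _ fun A hA => Submodule.sum_mem _ fun V hV => Submodule.smul_mem _ _ ?_
  rw [Psi3_eq_sum e S S₀ T q tx r heS hcoord A V hV]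
  obtain ⟨hAS, hA2⟩ := Finset.mem_powersetCard.mp hA
  obtain ⟨x, y, hxy, rfl⟩ := Finset.card_eq_two.mp hA2
  have hx : x ∈ S := hAS (by simp)
  have hy : y ∈ S := hAS (by simp)
  exact Submodule.sum_mem _ fun p₀ hp₀ =>
    Submodule.smul_mem _ _ (psi3_mem_span e S S₀ r heS hS₀ hδ x y p₀ hx hy hxy hp₀)

omit [DecidableEq n] in
/-- The size of the spanning family. -/
theorem card_TIdx : Fintype.card (TIdx e S S₀) =
    (Finset.univ.filter fun k => (e k).card ≠ 3).card +
      (((S \ S₀).card.choose 2) * S₀.card + ((S \ S₀).card * (S₀.card + 1).choose 2 + (S₀.card).choose 3)) := by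
  classical
  rw [Fintype.card_sum, Fintype.card_sum, Fintype.card_sum, Fintype.card_prod, Fintype.card_prod,
    Fintype.card_coe, Fintype.card_coe, Fintype.card_coe, Fintype.card_coe, Fintype.card_coe,
    Fintype.card_subtype, Finset.card_powersetCard, Finset.card_sym2, Finset.card_powersetCard]

/-! ### The arithmetic of the count -/

/-- The size of the kept family with `d` states outside and `e` inside `S₀`. -/
def kept (d e : ℕ) : ℕ := d.choose 2 * e + d * (e + 1).choose 2 + e.choose 3

/-- Moving one state into `S₀`: `kept d (e+1) + e = kept (d+1) e + C(d+1, 2)`. -/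
theorem kept_step (d e : ℕ) : kept d (e + 1) + e = kept (d + 1) e + (d + 1).choose 2 := by
  have h1 : (d + 1).choose 2 = d + d.choose 2 := by
    rw [Nat.choose_succ_succ, Nat.choose_one_right]
  have h2 : (e + 2).choose 2 = (e + 1) + (e + 1).choose 2 := by
    rw [Nat.choose_succ_succ, Nat.choose_one_right]
  have h3 : (e + 1).choose 3 = e.choose 2 + e.choose 3 := by
    rw [Nat.choose_succ_succ]
  have h4 : (e + 1).choose 2 = e + e.choose 2 := by
    rw [Nat.choose_succ_succ, Nat.choose_one_right]
  simp only [kept]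
  rw [h1, h2, h3, h4]
  ring

/-- **The count**: for `e ≤ N ≤ n = d + e` and `N ≤ C(n − N, 2)`,
`kept d e + n·C(N,2) ≤ C(n,2)·N + C(N,3)` (the maximum over `e` is attained at `e = N`). -/
theorem kept_le {d e N n : ℕ} (hde : d + e = n) (heN : e ≤ N) (hNn : N ≤ n) (hsep : N ≤ (n - N).choose 2) :
    kept d e + n * N.choose 2 ≤ n.choose 2 * N + N.choose 3 := by
  -- the value at `e = N`
  have htop : kept (n - N) N + n * N.choose 2 = n.choose 2 * N + N.choose 3 := by
    obtain ⟨c, rfl⟩ := Nat.exists_eq_add_of_le hNn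
    rw [Nat.add_sub_cancel_left, kept]
    have h : ((c.choose 2 * N + c * (N + 1).choose 2 + N.choose 3 + (N + c) * N.choose 2 : ℕ) : ℚ) =
        (((N + c).choose 2 * N + N.choose 3 : ℕ) : ℚ) := by
      push_cast
      simp only [Nat.cast_choose_two]
      push_cast
      ring
    exact_mod_cast h
  -- monotonicity in `e` below `N`
  have hmono : ∀ m d e, d + e = n → e + m = N → kept d e ≤ kept (n - N) N := by
    intro m
    induction m with
    | zero =>
      intro d e hde heN
      have he : e = N := by omega
      have hd : d = n - N := by omega
      subst he; subst hd; exact le_rfl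
    | succ m ih =>
      intro d e hde heN
      obtain ⟨d', rfl⟩ : ∃ d', d = d' + 1 := ⟨d - 1, by omega⟩
      have hstep := kept_step d' e
      have hd'e : e ≤ (d' + 1).choose 2 := by
        have h' : (n - N).choose 2 ≤ (d' + 1).choose 2 := Nat.choose_le_choose 2 (by omega)
        omega
      have := ih d' (e + 1) (by omega) (by omega)
      omega
  have := hmono (N - e) d e hde (by omega)
  omega

/-- **THE TRIPLE SPAN BOUND, singular form.** Three-state members inside `S` (`|S| = n`), rows of size `≤ s < 3(q+1)`
inside `T`, `N = #{V ⊆ T : |V| ≤ q}` with `N ≤ n` and `N ≤ C(n − N, 2)`: if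
`#{k : |e k| ≠ 3} + C(n,2)·N + C(N,3) < #columns + n·C(N,2)`, the additive matrix is singular FOR EVERY TABLE. -/
theorem det_eq_zero_triples {s : ℕ} (hsq : s < 3 * (q + 1))
    (heS : ∀ k, (e k).card = 3 → e k ⊆ S) (hus : ∀ i, (u i).card ≤ s) (huT : ∀ i, u i ⊆ T)
    (hNS : (smallSets T q).card ≤ S.card) (hsep : (smallSets T q).card ≤ (S.card - (smallSets T q).card).choose 2)
    (hcount : (Finset.univ.filter fun k => (e k).card ≠ 3).card + S.card.choose 2 * (smallSets T q).card +
        ((smallSets T q).card).choose 3 < Fintype.card n + S.card * ((smallSets T q).card).choose 2) :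
    (Matrix.of fun i k : n => ∏ a ∈ u i, (tx none a + ∑ p ∈ e k, tx (some p) a)).det = 0 := by
  classical
  obtain ⟨S₀, hS₀, hcard₀, r, hδ, hcoord⟩ := exists_coords S T q tx
  set M : Matrix n n ℂ := Matrix.of fun i k : n => ∏ a ∈ u i, (tx none a + ∑ p ∈ e k, tx (some p) a) with hM
  by_contra hdet
  have hunit : IsUnit M := (Matrix.isUnit_iff_isUnit_det M).mpr (isUnit_iff_ne_zero.mpr hdet)
  have hrows : LinearIndependent ℂ (fun i : n => M i) := Matrix.linearIndependent_rows_of_isUnit hunit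
  set W : Submodule ℂ (n → ℂ) := Submodule.span ℂ (Set.range (famVec3 e S S₀ r)) with hW
  have hmem : ∀ i : n, M i ∈ W := fun i =>
    row_mem_span_triples u e S S₀ T q tx r hsq heS hS₀ hδ hcoord i (huT i) (hus i)
  let w : n → W := fun i => ⟨M i, hmem i⟩
  have hw : LinearIndependent ℂ w := LinearIndependent.of_comp W.subtype hrows
  have h1 : Fintype.card n ≤ Module.finrank ℂ W := hw.fintype_card_le_finrank
  have h2 : Module.finrank ℂ W ≤ Fintype.card (TIdx e S S₀) := finrank_range_le_card (famVec3 e S S₀ r)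
  rw [card_TIdx] at h2
  have key := kept_le (N := (smallSets T q).card) (Finset.card_sdiff_add_card_eq_card hS₀) hcard₀ hNS hsep
  simp only [kept] at key
  omega

end rows

end ShadowRank

end

end Summit.ValiantsHypothesis.ValiantsHypothesis.Theorems.BarrierLever.HiddenStates
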